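import Mathlib.LinearAlgebra.Matrix.BilinearForm
import Mathlib.LinearAlgebra.BilinearForm.Orthogonal
import Mathlib.Algebra.Field.ZMod
import Literature.Computability.MetaComplexity.LowDegreeClosure
import HarnessLib

/-!
# Smolensky's lemma: the Hilbert function of the support of a low-degree polynomial is at most half its size

**Lemma** (Smolensky 1993; Moran–Rashtchian 2016, Lemma 7.2: "Let `p : {0,1}ⁿ → F` and define
`P = {x : p(x) ≠ 0}`. If `d < (n − deg p)/2` then `rk(E^{d,P}) ≤ |P|/2`", where `rk(E^{d,P})` is
the affine Hilbert function `h_P(d)`): `two_mul_finrank_restrict_support_le_card` — for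
`p ∈ lowDeg F n e` and `2t + e < n`, `2·dim_F {q|_P : q ∈ lowDeg F n t} ≤ |P|` for `P = {p ≠ 0}`,
over any field `F` (the restriction space is `(lowDeg F n t).map (funLeft F F Subtype.val)`; its
dimension is the tree's `hilbertFn F P t` of `LowDegreeClosure.lean` by
`hilbertFn_eq_finrank_map_funLeft` in `HilbertFunctionLowerBound.lean`).

Proof (ours — a weighted-isotropy argument; the printed proof manipulates the rank of the
inclusion matrix `E^{d,P}` directly): on `F^P` consider the diagonal symmetric bilinear form
`β(x, y) = Σ_{u ∈ P} ḡ(u) p(u) x(u) y(u)` with `ḡ(u) = (−1)^{|u|}` the `±1` parity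
(`pmMono F univ`), non-degenerate because its weights are non-zero. For restrictions `x = q₁|_P`,
`y = q₂|_P` of polynomials of degree `≤ t`, `β(x, y) = Σ_{u ∈ {0,1}ⁿ} ḡ(u) (p q₁ q₂)(u)` (as `p = 0`
off `P`), and the alternating sum `Σ_u ḡ(u) h(u)` — the top (`x₁⋯xₙ`-) coefficient of a
multilinear `h` up to sign — vanishes for `deg h ≤ e + 2t < n`
(`sum_pmMono_univ_mul_eq_zero_of_mem_lowDeg`: flip a variable outside the monomial). So
`(lowDeg t)|_P` is totally isotropic for `β`, whence `2·dim ≤ dim F^P = |P|`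
(`LinearMap.BilinForm.finrank_orthogonal`).
The QuantumAdvantage cell qa-qnc0 (planner file Sketch5.lean, `SmolenskyHalf`) uses the `𝔽₂`
instance `smolenskyHalf_F2` (same restriction form).

## References
* S. Jukna, *Boolean Function Complexity*, Springer 2012, §2.1 [JuknaBFC2012].
* R. Smolensky, *On representations by low-degree polynomials*, FOCS 1993 [Smolensky1993].
* S. Moran, C. Rashtchian, *Shattered sets and the Hilbert function*, MFCS 2016, Lemma 7.2 and
  Theorem 2.4 [MoranRashtchian2016].
-/

noncomputable section

namespace Literature.Computability.MetaComplexity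

namespace Smolensky

open Finset

variable {F : Type*} [Field F] {n : ℕ}

/-! ### The alternating sum over the cube kills low degree -/

/-- Flipping one coordinate changes the sign of the `±1` parity `ḡ = pmMono F univ`. [folklore] -/
private theorem pmMono_univ_update_not (u : Fin n → Bool) (i : Fin n) :
    pmMono F univ (Function.update u i (!u i)) = -pmMono F univ u := by
  simp only [pmMono]
  rw [← Finset.mul_prod_erase univ (sgn F (Function.update u i (!u i))) (mem_univ i),
    ← Finset.mul_prod_erase univ (sgn F u) (mem_univ i)]
  have hrest : ∏ j ∈ univ.erase i, sgn F (Function.update u i (!u i)) j =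
      ∏ j ∈ univ.erase i, sgn F u j := by
    refine Finset.prod_congr rfl fun j hj => ?_
    simp only [sgn, Function.update_of_ne (ne_of_mem_erase hj)]
  have hi : sgn F (Function.update u i (!u i)) i = -sgn F u i := by
    simp only [sgn, Function.update_self]
    cases u i <;> simp
  rw [hrest, hi, neg_mul]

/-- **The alternating sum kills low degree**: `Σ_{u ∈ {0,1}ⁿ} ḡ(u) h(u) = 0` for
`h ∈ lowDeg F n D`, `D < n`, any field. By Möbius inversion the coefficient of `x₁⋯xₙ` in the
unique multilinear representative of `h` is `c_{[n]} = Σ_T (−1)^{n−|T|} h(T) = (−1)ⁿ Σ_u ḡ(u) h(u)`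
(Jukna, eq. (2.1) with `S = [n]`, as in the proof of Lemma 2.1), and it vanishes when
`deg h < n`. Our proof is direct: for a monomial `x_S` with `|S| < n`, flipping a coordinate
outside `S` is a sign-reversing involution of the sum.
[cite: JuknaBFC2012, §2.1, eq. (2.1) (Möbius inversion) and proof of Lemma 2.1] -/
theorem sum_pmMono_univ_mul_eq_zero_of_mem_lowDeg {D : ℕ} (hD : D < n) {h : CubeFn F n}
    (hh : h ∈ lowDeg F n D) : ∑ u : Fin n → Bool, pmMono F univ u * h u = 0 := by
  rw [lowDeg_eq_span] at hh
  induction hh using Submodule.span_induction with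
  | mem x hx =>
    obtain ⟨⟨S, hS⟩, rfl⟩ := hx
    show ∑ u : Fin n → Bool, pmMono F univ u * mono F S u = 0
    -- a coordinate outside `S`
    have hlt : S.card < (univ : Finset (Fin n)).card := by
      rw [Finset.card_univ, Fintype.card_fin]; omega
    obtain ⟨i, -, hi⟩ := Finset.exists_mem_notMem_of_card_lt_card hlt
    have hmono : ∀ u : Fin n → Bool, mono F S (Function.update u i (!u i)) = mono F S u := by
      intro u
      rw [mono_apply, mono_apply]
      have hiff : (∀ j ∈ S, Function.update u i (!u i) j = true) ↔ ∀ j ∈ S, u j = true := by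
        refine forall₂_congr fun j hj => ?_
        rw [Function.update_of_ne (ne_of_mem_of_not_mem hj hi)]
      simp only [hiff]
    -- the flip `u ↦ update u i (!u i)` is a sign-reversing involution preserving `mono S`
    refine Finset.sum_ninvolution (fun u => Function.update u i (!u i)) ?_ ?_ ?_ ?_
    · intro u
      rw [hmono, pmMono_univ_update_not]
      ring
    · intro u _ heq
      have := congrFun heq i
      simp at this
    · intro u
      exact mem_univ _
    · intro u
      funext j
      by_cases hj : j = i
      · subst hj; simp
      · simp [Function.update_of_ne hj]
  | zero => simp
  | add x y _ _ hx hy =>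
    simp only [Pi.add_apply, mul_add, sum_add_distrib, hx, hy, add_zero]
  | smul c x _ hx =>
    have hfac : ∑ u : Fin n → Bool, pmMono F univ u * (c • x) u =
        c * ∑ u : Fin n → Bool, pmMono F univ u * x u := by
      rw [Finset.mul_sum]
      refine Finset.sum_congr rfl fun u _ => ?_
      simp only [Pi.smul_apply, smul_eq_mul]
      ring
    rw [hfac, hx, mul_zero]

/-! ### Smolensky's lemma -/

/-- **Smolensky's lemma**, restriction form (Smolensky 1993; Moran–Rashtchian 2016, Lemma 7.2):
if `p` has degree `≤ e` and `2t + e < n`, then the space of restrictions `q|_P`, `deg q ≤ t`, to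
`P = {p ≠ 0}` has dimension at most `|P|/2`. Any field. [cite: MoranRashtchian2016, Lemma 7.2] -/
theorem two_mul_finrank_restrict_support_le_card [DecidableEq F] {e t : ℕ} {p : CubeFn F n}
    (hp : p ∈ lowDeg F n e) (het : 2 * t + e < n) :
    2 * Module.finrank F ↥((lowDeg F n t).map (LinearMap.funLeft F F
        (Subtype.val : ↥(univ.filter fun u : Fin n → Bool => p u ≠ 0) → (Fin n → Bool)))) ≤
      (univ.filter fun u : Fin n → Bool => p u ≠ 0).card := by
  generalize hP : (univ.filter fun u : Fin n → Bool => p u ≠ 0) = P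
  have hmemP : ∀ u : Fin n → Bool, u ∈ P ↔ p u ≠ 0 := fun u => by rw [← hP]; simp
  -- the weighted diagonal form on `F^P`
  obtain ⟨c, hc⟩ : ∃ c : ↥P → F, c = fun i => pmMono F univ i.1 * p i.1 := ⟨_, rfl⟩
  have hc0 : ∀ i : ↥P, c i ≠ 0 := by
    intro i
    rw [hc]
    show pmMono F univ i.1 * p i.1 ≠ 0
    refine mul_ne_zero ?_ ((hmemP i.1).1 i.2)
    intro h0
    have h1 := congrFun (pmMono_mul_self (F := F) (univ : Finset (Fin n))) i.1
    rw [Pi.mul_apply, h0, mul_zero, Pi.one_apply] at h1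
    exact zero_ne_one h1
  obtain ⟨β, hβ⟩ : ∃ β : LinearMap.BilinForm F (↥P → F), β = Matrix.toBilin' (Matrix.diagonal c) :=
    ⟨_, rfl⟩
  have hβapply : ∀ x y : ↥P → F, β x y = ∑ i : ↥P, x i * c i * y i := by
    intro x y
    rw [hβ, Matrix.toBilin'_apply]
    refine sum_congr rfl fun i _ => ?_
    rw [sum_eq_single i]
    · rw [Matrix.diagonal_apply_eq]
    · intro j _ hji
      rw [Matrix.diagonal_apply_ne _ (Ne.symm hji)]
      ring
    · intro h; exact absurd (mem_univ i) h
  have hnd : β.Nondegenerate := by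
    rw [hβ]
    refine LinearMap.BilinForm.nondegenerate_toBilin'_of_det_ne_zero' _ ?_
    rw [Matrix.det_diagonal]
    exact prod_ne_zero_iff.2 fun i _ => hc0 i
  -- the restricted low-degree space is totally isotropic
  have hiso : (lowDeg F n t).map (LinearMap.funLeft F F (Subtype.val : ↥P → (Fin n → Bool))) ≤
      β.orthogonal
        ((lowDeg F n t).map (LinearMap.funLeft F F (Subtype.val : ↥P → (Fin n → Bool)))) := by
    intro y hy
    rw [LinearMap.BilinForm.mem_orthogonal_iff]
    intro x hx
    obtain ⟨q₁, hq₁, rfl⟩ := Submodule.mem_map.1 hx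
    obtain ⟨q₂, hq₂, rfl⟩ := Submodule.mem_map.1 hy
    show β (LinearMap.funLeft F F Subtype.val q₁) (LinearMap.funLeft F F Subtype.val q₂) = 0
    rw [hβapply]
    have hprod : p * q₁ * q₂ ∈ lowDeg F n (e + t + t) :=
      mul_mem_lowDeg_add (mul_mem_lowDeg_add hp hq₁) hq₂
    have hzero := sum_pmMono_univ_mul_eq_zero_of_mem_lowDeg (F := F) (by omega) hprod
    -- rewrite the sum over `↥P` as the alternating sum over the whole cube
    have h1 : ∑ i : ↥P, (LinearMap.funLeft F F Subtype.val q₁) i * c i *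
        (LinearMap.funLeft F F Subtype.val q₂) i =
        ∑ u ∈ P, pmMono F univ u * (p * q₁ * q₂) u := by
      rw [← sum_coe_sort P]
      refine sum_congr rfl fun i _ => ?_
      simp only [LinearMap.funLeft_apply, hc, Pi.mul_apply]
      ring
    have h2 : ∑ u ∈ P, pmMono F univ u * (p * q₁ * q₂) u =
        ∑ u : Fin n → Bool, pmMono F univ u * (p * q₁ * q₂) u := by
      refine (sum_subset (subset_univ P) fun u _ hu => ?_)
      have hpu : p u = 0 := by
        by_contra hne
        exact hu ((hmemP u).2 hne)
      simp [hpu]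
    exact h1.trans (h2.trans hzero)
  -- dimension count: `dim W ≤ dim W^⊥ = |P| - dim W`
  have hfin := LinearMap.BilinForm.finrank_orthogonal hnd
    ((lowDeg F n t).map (LinearMap.funLeft F F (Subtype.val : ↥P → (Fin n → Bool))))
  have hmono := Submodule.finrank_mono hiso
  have hamb : Module.finrank F (↥P → F) = P.card := by
    rw [Module.finrank_fintype_fun_eq_card, Fintype.card_coe]
  have hWle := Submodule.finrank_le
    ((lowDeg F n t).map (LinearMap.funLeft F F (Subtype.val : ↥P → (Fin n → Bool))))
  omega

/-- **The `𝔽₂` form used by the QuantumAdvantage cell qa-qnc0** (planner file Sketch5.lean,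
`SmolenskyHalf`, restriction form of the Hilbert function): for `g ∈ lowDeg 𝔽₂ n d` and
`2t + d < n`, `2 · dim_{𝔽₂} {q|_{supp g} : deg q ≤ t} ≤ |supp g|`.
[cite: MoranRashtchian2016, Lemma 7.2] -/
theorem smolenskyHalf_F2 :
    ∀ n d t : ℕ, 2 * t + d < n → ∀ g : CubeFn (ZMod 2) n, g ∈ lowDeg (ZMod 2) n d →
      2 * Module.finrank (ZMod 2) ↥((lowDeg (ZMod 2) n t).map (LinearMap.funLeft (ZMod 2) (ZMod 2)
          (Subtype.val : ↥(univ.filter fun u : Fin n → Bool => g u ≠ 0) → (Fin n → Bool)))) ≤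
        (univ.filter fun u : Fin n → Bool => g u ≠ 0).card :=
  fun _ _ _ h _ hg => two_mul_finrank_restrict_support_le_card hg h

end Smolensky

end Literature.Computability.MetaComplexity
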